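import Literature.NumberTheory.Automorphic.CutoffCoefficientIdempotent
import Literature.NumberTheory.Automorphic.GLnLocalUnimodular
import Literature.NumberTheory.Automorphic.SupercuspidalTestFunctions
import Literature.NumberTheory.Automorphic.SupercuspFormUnipotentIntegral
import Literature.NumberTheory.Automorphic.AutomorphicQuotientKernelConvolution
import HarnessLib

/-!
# Gelbart's idempotent at a supercuspidal place: a self-adjoint idempotent supercusp form
# `e(g) = 1_{|det g| = 1} ⟪F(π(g) u), F u⟫` with `π(e) u = c u ≠ 0`
(Gelbart, *Automorphic forms on adele groups* (1975), §10, p. 153 and (10.11): "`f_v` is the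
matrix coefficient `d(σ_v) conj ⟨σ_v(g) u_v, u_v⟩` … these functions are idempotents";
Harish-Chandra (1970), Part I §3; Bernstein–Zelevinsky (1976), §2.40–2.44)

Topic `NumberTheory/Automorphic`; one definition with body (`GLn.detUnit`, the open subgroup
`{g : |det g| = 1}` of `GL_n(F)`) and theorems; no named fact, no instance visible to importers.

In the comparison of trace formulas (Gelbart, Thm. 10.5) the test functions are `Φ = ξ_S ⊗ f` with
a **fixed** factor `ξ_v` at each ramified place: the normalised matrix coefficient of the
supercuspidal local component `π_v`, an idempotent of the Hecke algebra modulo the centre. The tree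
works with test functions compactly supported on the group (no central character), so the matrix
coefficient — compactly supported only modulo the centre — is cut off to the open subgroup
`G⁰ = {g : |det g| = 1}`, on which it *is* compactly supported; the price is that for a general
vector `u` the cut-off coefficient is no longer an idempotent. With the vector `u` provided by the
variational theorem `CutoffCoefficient.exists_eCoeff_eigenvector` it is:

* `GLn.detUnit n F` — `G⁰`, a subgroup containing `GL_n(𝒪)` (`isOpen_detUnit`); the cut-off
  coefficients `1_{G⁰}(h) ⟪F x, F(π(h) y)⟫` of a smooth **supercuspidal** `π` with a unitary
  structure `F : V → H` are compactly supported (`hasCompactSupport_cutCoeff_detUnit`: supports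
  lie in `(C · Z) ∩ G⁰`, compact by `exists_isCompact_forall_mem_center_mul_det`);
* `exists_supercuspidalIdempotent` — **for `π` smooth, admissible, supercuspidal, `V ≠ 0`, with a
  unitary structure `F` (injective, `⟪F(π g x), F(π g y)⟫ = ⟪F x, F y⟫`), and a Haar measure `μ`
  on `GL_n(F)` (`0 < n`), there are a vector `u` with `‖F u‖ = 1`, a constant `c > 0` and
  `e ∈ C_c(GL_n(F))`, `e(g) = 1_{G⁰}(g) ⟪F(π(g) u), F u⟫`, with**
  (i) `e^* = e` (`mulStar`), (ii) `e ⋆_μ e = c e` (`mulConv`), (iii) `e` is a supercusp form: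
  `∫_{𝔫_k(F)} e(a (1 + Y) b) dY = 0` for `0 < k < n` (`integral_matrixCoeff_unipotent_eq_zero`:
  `det (1 + Y) = 1`, so the cut-off is constant along `N_k`), (iv) `∫ e(g) ũ(π(g) u) dμ = c ũ(u)`
  for every linear form `ũ` — `π(e) u = c u`, in particular `≠ 0` against `ũ = ⟪F u, F ·⟫`.

So at each place `v ∈ Ram(D)` where the cuspidal `π` is supercuspidal, Gelbart's fixed factor
exists in the tree's setting: it feeds `GLn.tensorCc`/`exists_discreteAutomorphicRep_of_localFactors`
(non-vanishing, via `integratedOperator_restrict_apply_ne_zero`) and the `*`-algebra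
`{ξ_S ⊗ f}` (`PlacesTestFunctionAlgebra`: `mulConv_tensorPi_of_idempotent`). Part of the inline
(D-0026) decomposition of
`Literature.NumberTheory.Automorphic.jacquetLanglands_transfer_surjective` (Gelbart Thm. 10.5 (ii)).

## References

* S. Gelbart, *Automorphic forms on adele groups*, Ann. of Math. Studies 83 (1975), §10, p. 153,
  (10.11) [Gelbart1975].
* Harish-Chandra, *Harmonic analysis on reductive `p`-adic groups*, LNM 162 (1970), Part I §3
  [HarishChandra1970].
* I. N. Bernstein, A. V. Zelevinsky, Russian Math. Surveys 31:3 (1976), §2.40–2.44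
  [BernsteinZelevinsky1976].
-/

noncomputable section

open MeasureTheory Measure Set Filter Topology ValuativeRel CompactlySupported
open scoped ComplexConjugate InnerProductSpace MatrixGroups

namespace Literature.NumberTheory.Automorphic

/-! ### The subgroup `G⁰ = {g : |det g| = 1}` -/

section DetUnit

variable (n : ℕ) (F : Type*) [Field F] [ValuativeRel F]

/-- **`G⁰ = {g ∈ GL_n(F) : |det g| = 1}`**, the kernel of `|det|` (an open normal subgroup
containing `GL_n(𝒪)`). [cite: Gelbart1975, §10 p. 153] -/
def GLn.detUnit : Subgroup (GL (Fin n) F) where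
  carrier := {g | valuation F ((g : Matrix (Fin n) (Fin n) F).det) = 1}
  mul_mem' {g h} hg hh := by
    change valuation F (((g * h : GL (Fin n) F)) : Matrix (Fin n) (Fin n) F).det = 1
    rw [Units.val_mul, Matrix.det_mul, map_mul, hg, hh, mul_one]
  one_mem' := by
    change valuation F (((1 : GL (Fin n) F)) : Matrix (Fin n) (Fin n) F).det = 1
    rw [Units.val_one, Matrix.det_one, map_one]
  inv_mem' {g} hg := by
    change valuation F (((g⁻¹ : GL (Fin n) F)) : Matrix (Fin n) (Fin n) F).det = 1
    rw [Matrix.coe_units_inv, Matrix.det_nonsing_inv, Ring.inverse_eq_inv', map_inv₀, hg, inv_one]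

variable {n F}

/-- Membership in `G⁰`. [folklore] -/
theorem GLn.mem_detUnit_iff (g : GL (Fin n) F) :
    g ∈ GLn.detUnit n F ↔ valuation F ((g : Matrix (Fin n) (Fin n) F).det) = 1 := Iff.rfl

/-- `GL_n(𝒪) ≤ G⁰`. [folklore] -/
theorem GLn.glInt_le_detUnit : glInt n F ≤ GLn.detUnit n F := fun _ hg =>
  (GLn.mem_detUnit_iff _).2 (valuation_det_eq_one_of_mem_glInt hg)

variable [TopologicalSpace F] [IsNonarchimedeanLocalField F]

/-- `G⁰` is open (it contains the open subgroup `GL_n(𝒪)`). [folklore] -/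
theorem GLn.isOpen_detUnit : IsOpen (GLn.detUnit n F : Set (GL (Fin n) F)) :=
  Subgroup.isOpen_mono GLn.glInt_le_detUnit (isOpen_glInt n F)

end DetUnit

/-! ### Cut-off coefficients of supercuspidals on `G⁰` are compactly supported -/

section Support

variable {F : Type*} [Field F] [ValuativeRel F] [TopologicalSpace F] [IsNonarchimedeanLocalField F]
  {n : ℕ} {V : Type*} [AddCommGroup V] [Module ℂ V] {π : Representation ℂ (GL (Fin n) F) V}
  {H : Type*} [NormedAddCommGroup H] [InnerProductSpace ℂ H] {Fv : V →ₗ[ℂ] H}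

/-- **The linear forms `⟪F x, F ·⟫` are smooth** (unitarity: their stabiliser contains `Stab(x)`).
[folklore] -/
theorem inner_comp_mem_contragredient (hπ : π.IsSmooth)
    (hF : ∀ (g : GL (Fin n) F) (x y : V), ⟪Fv (π g x), Fv (π g y)⟫_ℂ = ⟪Fv x, Fv y⟫_ℂ) (x : V) :
    ((innerₛₗ ℂ (Fv x)).comp Fv : Module.Dual ℂ V) ∈ π.contragredient := by
  rw [Representation.mem_contragredient, Representation.isSmoothVector_iff]
  refine Subgroup.isOpen_mono (H₁ := π.stabilizerSubgroup x) (fun g hg => ?_) (hπ x)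
  rw [Representation.mem_stabilizerSubgroup] at hg ⊢
  refine LinearMap.ext fun v => ?_
  rw [Representation.dual_apply, Module.Dual.transpose_apply, LinearMap.comp_apply, LinearMap.comp_apply,
    LinearMap.comp_apply, innerₛₗ_apply_apply, innerₛₗ_apply_apply, ← hF g x (π g⁻¹ v), hg,
    ← Module.End.mul_apply, ← map_mul, mul_inv_cancel, map_one, Module.End.one_apply]

/-- **Cut-off coefficients of a supercuspidal are compactly supported on `G⁰`**: the support of
`h ↦ 1_{G⁰}(h) ⟪F x, F(π(h) y)⟫` lies in `(C · Z) ∩ G⁰` for a compact `C` (`IsSupercuspidal`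
applied to the smooth form `⟪F x, F ·⟫`), which is contained in a compact set
(`exists_isCompact_forall_mem_center_mul_det` with `|ϖ|ⁿ < |det| ≤ 1`). [folklore] -/
theorem hasCompactSupport_cutCoeff_detUnit (hn : 0 < n) (hπ : π.IsSmooth) (hsc : π.IsSupercuspidal)
    (hF : ∀ (g : GL (Fin n) F) (x y : V), ⟪Fv (π g x), Fv (π g y)⟫_ℂ = ⟪Fv x, Fv y⟫_ℂ) (x y : V) :
    HasCompactSupport (CutoffCoefficient.cutCoeff π Fv (GLn.detUnit n F) x y) := by
  haveI := (GaloisRepresentations.IsNonarchimedeanLocalField.isLocalField F).toT2Space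
  haveI : T2Space (Matrix (Fin n) (Fin n) F) := inferInstanceAs (T2Space (Fin n → Fin n → F))
  obtain ⟨C, hC, hsupp⟩ := hsc _ (inner_comp_mem_contragredient hπ hF x) y
  obtain ⟨ϖ, hϖ⟩ := exists_isUniformizingElement (F := F)
  have hv1 : valuation F ϖ < 1 := hϖ.valuation_lt_one
  obtain ⟨T, hT, hTmem⟩ := exists_isCompact_forall_mem_center_mul_det hn hC hϖ
  refine HasCompactSupport.intro hT fun g hg => ?_
  by_contra hne
  have hg0 : g ∈ GLn.detUnit n F := by
    by_contra h
    exact hne (CutoffCoefficient.cutCoeff_of_not_mem h x y)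
  have hval : valuation F ((g : Matrix (Fin n) (Fin n) F).det) = 1 := hg0
  rw [CutoffCoefficient.cutCoeff_of_mem hg0] at hne
  have hmem : g ∈ Function.support (π.matrixCoeff ((innerₛₗ ℂ (Fv x)).comp Fv) y) := by
    rw [Function.mem_support]
    change ((innerₛₗ ℂ (Fv x)).comp Fv) (π g y) ≠ 0
    rwa [LinearMap.comp_apply, innerₛₗ_apply_apply]
  exact hg (hTmem g (hsupp hmem) (by rw [hval]; exact pow_lt_one' hv1 hn.ne') (le_of_eq hval))

end Support

/-! ### The idempotent -/

section Idempotent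

variable {F : Type*} [Field F] [ValuativeRel F] [TopologicalSpace F] [IsNonarchimedeanLocalField F]
  {n : ℕ} {V : Type*} [AddCommGroup V] [Module ℂ V] (π : Representation ℂ (GL (Fin n) F) V)
  {H : Type*} [NormedAddCommGroup H] [InnerProductSpace ℂ H] (Fv : V →ₗ[ℂ] H)
  [MeasurableSpace (GL (Fin n) F)] [BorelSpace (GL (Fin n) F)]

/-- **Gelbart's idempotent at a supercuspidal place, in the tree's setting** (Gelbart (1975),
p. 153, (10.11)). Let `π` be a smooth admissible supercuspidal complex representation of `GL_n(F)`
(`0 < n`) on `V ≠ 0` with a unitary structure: an injective linear `F : V → H` into a complex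
inner product space with `⟪F(π g x), F(π g y)⟫ = ⟪F x, F y⟫`; let `μ` be a Haar measure on
`GL_n(F)`. Then there are `u ∈ V` with `‖F u‖ = 1`, `c > 0` and `e ∈ C_c(GL_n(F))`,
`e(g) = 1_{|det g| = 1} ⟪F(π(g) u), F u⟫`, such that
(i) `e^*(g) = conj e(g⁻¹) = e(g)`; (ii) `(e ⋆_μ e)(g) = c e(g)`;
(iii) `∫_{𝔫_k(F)} e(a (1 + Y) b) dY = 0` for all `0 < k < n`, `a`, `b` (a supercusp form);
(iv) `∫ e(g) ũ(π(g) u) dμ(g) = c ũ(u)` for every linear form `ũ` on `V` (so `π(e) u = c u ≠ 0`).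
The vector `u` is that of `CutoffCoefficient.exists_eCoeff_eigenvector` for `G₀ = G⁰`,
`K₁ = GL_n(𝒪) ∩ Stab(v₀)`; (i) is unitarity, (ii) is (iv) applied to `ũ = ⟪F(π(g) u), F ·⟫`,
(iii) is `integral_matrixCoeff_unipotent_eq_zero` (the cut-off is constant along `N_k` as
`det(1 + Y) = 1`). [cite: Gelbart1975, §10 p. 153, (10.11)] -/
theorem exists_supercuspidalIdempotent (hn : 0 < n) (hπa : π.IsAdmissible) (hsc : π.IsSupercuspidal)
    (hF : ∀ (g : GL (Fin n) F) (x y : V), ⟪Fv (π g x), Fv (π g y)⟫_ℂ = ⟪Fv x, Fv y⟫_ℂ)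
    (hFi : Function.Injective Fv) {v₀ : V} (hv₀ : v₀ ≠ 0) [SecondCountableTopology (GL (Fin n) F)]
    (μ : Measure (GL (Fin n) F)) [μ.IsHaarMeasure] :
    ∃ u : V, ∃ c : ℝ, ∃ e : C_c(GL (Fin n) F, ℂ), ‖Fv u‖ = 1 ∧ 0 < c ∧
      (∀ g, e g = CutoffCoefficient.eCoeff π Fv (GLn.detUnit n F) u g) ∧
      (∀ g, mulStar (⇑e) g = e g) ∧
      (∀ g, mulConv μ (⇑e) (⇑e) g = c * e g) ∧
      (∀ k, 0 < k → k < n → ∀ [MeasurableSpace (blockNilpotent n k F)] [BorelSpace (blockNilpotent n k F)]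
        (α : Measure (blockNilpotent n k F)) [α.IsAddHaarMeasure] (a b : GL (Fin n) F),
        ∫ Y, e (a * unipotentOfBlock n k F (Multiplicative.ofAdd Y) * b) ∂α = 0) ∧
      (∀ ut : Module.Dual ℂ V, ∫ g, e g * ut (π g u) ∂μ = c * ut u) := by
  classical
  haveI : IsTopologicalRing F := inferInstance
  haveI := (GaloisRepresentations.IsNonarchimedeanLocalField.isLocalField F).toT2Space
  haveI : T2Space (Matrix (Fin n) (Fin n) F) := inferInstanceAs (T2Space (Fin n → Fin n → F))
  haveI : LocallyCompactSpace (Matrix (Fin n) (Fin n) F) :=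
    inferInstanceAs (LocallyCompactSpace (Fin n → Fin n → F))
  haveI : LocallyCompactSpace (GL (Fin n) F) := inferInstance
  have hπ : π.IsSmooth := hπa.isSmooth
  set G₀ : Subgroup (GL (Fin n) F) := GLn.detUnit n F with hG₀def
  have hG₀ : IsOpen (G₀ : Set (GL (Fin n) F)) := GLn.isOpen_detUnit
  -- the level `K₁ = GL_n(𝒪) ∩ Stab(v₀)`, compact open, with `v₀ ∈ V^{K₁} ≠ 0`
  set K₁ : Subgroup (GL (Fin n) F) := glInt n F ⊓ π.stabilizerSubgroup v₀ with hK₁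
  have hK₁o : IsOpen (K₁ : Set (GL (Fin n) F)) := (isOpen_glInt n F).inter (hπ v₀)
  have hK₁c : IsCompact (K₁ : Set (GL (Fin n) F)) :=
    (isCompact_glInt n F).of_isClosed_subset (Subgroup.isClosed_of_isOpen _ hK₁o) fun g hg => hg.1
  have hK₁G₀ : K₁ ≤ G₀ := fun g hg => GLn.glInt_le_detUnit hg.1
  haveI : Module.Finite ℂ (π.fixedPoints K₁) := hπa.finite_fixedPoints ⟨K₁, hK₁o⟩ hK₁c
  have hne : ∃ v ∈ π.fixedPoints K₁, v ≠ 0 :=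
    ⟨v₀, (π.mem_fixedPoints K₁ v₀).2 fun g hg => hg.2, hv₀⟩
  -- compact support of the cut-off coefficients, unimodularity
  have hcs : ∀ x y : V, HasCompactSupport (CutoffCoefficient.cutCoeff π Fv G₀ x y) :=
    hasCompactSupport_cutCoeff_detUnit hn hπ hsc hF
  haveI : μ.IsInvInvariant := GLn.isInvInvariant_of_isHaarMeasure_local n F μ
  -- the variational vector
  obtain ⟨u, huK, hu1, c, hc, heig⟩ :=
    CutoffCoefficient.exists_eCoeff_eigenvector hG₀ hπ hcs μ hF hFi hK₁G₀ hne
  -- the test function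
  let e : C_c(GL (Fin n) F, ℂ) :=
    ⟨⟨CutoffCoefficient.eCoeff π Fv G₀ u, CutoffCoefficient.continuous_eCoeff hG₀ (hπ u)⟩,
      CutoffCoefficient.hasCompactSupport_eCoeff (hcs u u)⟩
  have he : ∀ g, e g = CutoffCoefficient.eCoeff π Fv G₀ u g := fun g => rfl
  refine ⟨u, c, e, hu1, hc, he, fun g => ?_, fun g => ?_, fun k hk hkn _ _ α _ a b => ?_, heig⟩
  · -- (i) `e^* = e`
    rw [mulStar_apply, he, he]
    by_cases hg : g ∈ G₀
    · rw [CutoffCoefficient.eCoeff_of_mem (G₀.inv_mem hg), CutoffCoefficient.eCoeff_of_mem hg,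
        inner_conj_symm, ← hF g u (π g⁻¹ u), ← Module.End.mul_apply, ← map_mul, mul_inv_cancel,
        map_one, Module.End.one_apply]
    · have hg' : g⁻¹ ∉ G₀ := fun h => hg (by simpa using G₀.inv_mem h)
      rw [CutoffCoefficient.eCoeff_of_not_mem hg', CutoffCoefficient.eCoeff_of_not_mem hg, map_zero]
  · -- (ii) `e ⋆ e = c e`
    rw [mulConv_apply]
    by_cases hg : g ∈ G₀
    · -- `e(y) e(y⁻¹ g) = e(y) ⟪F(π g u), F(π y u)⟫`
      have h1 : ∀ y, e y * e (y⁻¹ * g) = e y * ((innerₛₗ ℂ (Fv (π g u))).comp Fv) (π y u) := by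
        intro y
        by_cases hy : y ∈ G₀
        · have hyg : y⁻¹ * g ∈ G₀ := G₀.mul_mem (G₀.inv_mem hy) hg
          rw [he (y⁻¹ * g), CutoffCoefficient.eCoeff_of_mem hyg, LinearMap.comp_apply, innerₛₗ_apply_apply,
            map_mul, Module.End.mul_apply, ← hF y (π y⁻¹ (π g u)) u, ← Module.End.mul_apply,
            ← map_mul, mul_inv_cancel, map_one, Module.End.one_apply]
        · rw [he y, CutoffCoefficient.eCoeff_of_not_mem hy, zero_mul, zero_mul]
      simp_rw [h1, he]
      rw [heig, LinearMap.comp_apply, innerₛₗ_apply_apply, CutoffCoefficient.eCoeff_of_mem hg]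
    · have h1 : ∀ y, e y * e (y⁻¹ * g) = 0 := by
        intro y
        by_cases hy : y ∈ G₀
        · have hyg : y⁻¹ * g ∉ G₀ := fun h => hg (by simpa using G₀.mul_mem hy h)
          rw [he (y⁻¹ * g), CutoffCoefficient.eCoeff_of_not_mem hyg, mul_zero]
        · rw [he y, CutoffCoefficient.eCoeff_of_not_mem hy, zero_mul]
      simp_rw [h1]
      rw [integral_zero, he g, CutoffCoefficient.eCoeff_of_not_mem hg, mul_zero]
  · -- (iii) supercusp form
    have hdet : ∀ Y : blockNilpotent n k F,
        (a * unipotentOfBlock n k F (Multiplicative.ofAdd Y) * b ∈ G₀ ↔ a * b ∈ G₀) := by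
      intro Y
      rw [GLn.mem_detUnit_iff, GLn.mem_detUnit_iff, det_coe_mul_unipotentOfBlock_mul, Units.val_mul,
        Matrix.det_mul]
    by_cases hab : a * b ∈ G₀
    · have h1 : ∀ Y : blockNilpotent n k F, e (a * unipotentOfBlock n k F (Multiplicative.ofAdd Y) * b) =
          conj (((innerₛₗ ℂ (Fv u)).comp Fv) (π (a * unipotentOfBlock n k F (Multiplicative.ofAdd Y) * b) u)) := by
        intro Y
        rw [he, CutoffCoefficient.eCoeff_of_mem ((hdet Y).2 hab), LinearMap.comp_apply, innerₛₗ_apply_apply,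
          inner_conj_symm]
      simp_rw [h1]
      rw [integral_conj]
      -- the conjugate of a matrix-coefficient unipotent integral, which vanishes
      have hcont : Continuous fun Y : blockNilpotent n k F =>
          ((innerₛₗ ℂ (Fv u)).comp Fv) (π (a * unipotentOfBlock n k F (Multiplicative.ofAdd Y) * b) u) :=
        (continuous_apply_comp_unipotentOfBlock π ((innerₛₗ ℂ (Fv u)).comp Fv) (hπ (π b u)) a).congr
          fun Y => by rw [map_mul π (a * _) b, Module.End.mul_apply]
      have hsupp : HasCompactSupport fun Y : blockNilpotent n k F =>
          ((innerₛₗ ℂ (Fv u)).comp Fv) (π (a * unipotentOfBlock n k F (Multiplicative.ofAdd Y) * b) u) := by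
        -- the coefficient restricted to `a N_k b ∩ supp`, compact by `hcs` (through `G⁰ ∋ a n b`)
        have h2 : (fun Y : blockNilpotent n k F =>
            ((innerₛₗ ℂ (Fv u)).comp Fv) (π (a * unipotentOfBlock n k F (Multiplicative.ofAdd Y) * b) u)) =
            fun Y => CutoffCoefficient.cutCoeff π Fv G₀ u u (a * unipotentOfBlock n k F (Multiplicative.ofAdd Y) * b) := by
          funext Y
          rw [CutoffCoefficient.cutCoeff_of_mem ((hdet Y).2 hab), LinearMap.comp_apply, innerₛₗ_apply_apply]
        rw [h2]
        exact hasCompactSupport_comp_unipotentOfBlock_local (hcs u u) a b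
      rw [integral_matrixCoeff_unipotent_eq_zero π hπ hsc hk hkn α _ u a b
        (hcont.integrable_of_hasCompactSupport hsupp), map_zero]
    · have h1 : ∀ Y : blockNilpotent n k F, e (a * unipotentOfBlock n k F (Multiplicative.ofAdd Y) * b) = 0 := by
        intro Y
        rw [he, CutoffCoefficient.eCoeff_of_not_mem (fun h => hab ((hdet Y).1 h))]
      simp_rw [h1]
      exact integral_zero _ _

end Idempotent

end Literature.NumberTheory.Automorphic
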